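import Mathlib
import Summits.MatrixMultiplication.MatrixMultiplication.Theorems.FidelityWitnessesFidelityGapThreeSeventeenPunctualDefs

/-!
# Borel-fixed border apolarity at `(⟨3,3,3⟩, 17)` — part 1: the graded ideal generated by a
# multiplicatively closed system of homogeneous pieces

Crux `stmt-MatrixMultiplication-4958` (`FidelityWitnesses.FidelityGapThreeSeventeen`), line
`punctual-saturation`, stub `stub_borelFixedApolarity` (helper file; general, reusable).

For a weight grading `w : σ → M` of `K[x_σ]` and a system of `K`-subspaces `V m ≤ S_m` of the
weighted homogeneous pieces with `V m · S_e ≤ V (m + e)` (the shape of the limit pieces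
`I_m = lim_{ε → 0} I(Γ_ε)_m` of border apolarity, Conner–Harper–Landsberg 2023 §2.3 (iii)), the ideal
`I = (⋃_m V m)` they generate is, as a `K`-subspace, exactly `⨆_m V m`
(`restrictScalars_span_iUnion_eq`); hence it is closed under taking weighted homogeneous components
and ITS PIECES ARE THE GIVEN ONES: `I ∩ S_m = V m` (`span_iUnion_inf_eq`).  Specialised to the
line's Cox ring `S = ℂ[C ⊕ A ⊕ B]` this is the registered sub-goal
`stub_borelFixedApolarity_graded` (the passage from the degreewise limits to ONE candidate ideal with
`piece I D = I_D`, `IsTrihomog I`).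

References: A. Conner, A. Harper, J. M. Landsberg, Forum Math. Pi 11 (2023) e17, §2.3;
W. Buczyńska, J. Buczyński, Duke Math. J. 170 (2021), §3 (multigraded ideals of the Cox ring).
Elementary; everything proved.
-/

noncomputable section

namespace Summit.MatrixMultiplication.MatrixMultiplication.Theorems.PunctualSaturation

-- single-conjunct summit: the `Summit.<S>.<P>` prefix repeats `MatrixMultiplication` by design (D-0017)
set_option linter.dupNamespace false

open MvPolynomial

namespace GradedSpan

variable {K : Type*} [Field K] {σ : Type*} {M : Type*} [AddCommMonoid M]
variable (w : σ → M) (V : M → Submodule K (MvPolynomial σ K))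

/-- The weighted homogeneous components of an element of `⨆_m V m` lie in the corresponding
`V n` (the `V m ≤ S_m` sit in independent summands). [folklore] -/
theorem weightedHomogeneousComponent_mem_of_mem_iSup [DecidableEq M]
    (hV : ∀ m, V m ≤ weightedHomogeneousSubmodule K w m) {f : MvPolynomial σ K}
    (hf : f ∈ ⨆ m, V m) (n : M) : weightedHomogeneousComponent w n f ∈ V n := by
  induction hf using Submodule.iSup_induction' with
  | mem m g hg =>
    rw [weightedHomogeneousComponent_of_mem (hV m hg)]
    split_ifs with h
    · subst h; exact hg
    · exact Submodule.zero_mem _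
  | zero => rw [map_zero]; exact Submodule.zero_mem _
  | add f g _ _ hf hg => rw [map_add]; exact Submodule.add_mem _ hf hg

/-- **The pieces of `⨆_m V m` are the `V n`**: `(⨆_m V m) ∩ S_n = V n`. [folklore] -/
theorem iSup_inf_eq (hV : ∀ m, V m ≤ weightedHomogeneousSubmodule K w m) (n : M) :
    (⨆ m, V m) ⊓ weightedHomogeneousSubmodule K w n = V n := by
  classical
  refine le_antisymm ?_ (le_inf (le_iSup V n) (hV n))
  rintro f ⟨hf, hfn⟩
  have h := weightedHomogeneousComponent_mem_of_mem_iSup w V hV hf n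
  rwa [weightedHomogeneousComponent_of_mem hfn, if_pos rfl] at h

/-- `⨆_m V m` is closed under multiplication by arbitrary polynomials as soon as
`V m · S_e ≤ V (m + e)` (split the multiplier into its homogeneous components). [folklore] -/
theorem mul_mem_iSup (hmul : ∀ m e, V m * weightedHomogeneousSubmodule K w e ≤ V (m + e))
    (g : MvPolynomial σ K) {f : MvPolynomial σ K} (hf : f ∈ ⨆ m, V m) : g * f ∈ ⨆ m, V m := by
  classical
  induction hf using Submodule.iSup_induction' with
  | mem m f hf =>
    rw [← sum_weightedHomogeneousComponent w g,
      finsum_eq_sum _ (weightedHomogeneousComponent_finsupp g), Finset.sum_mul]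
    refine Submodule.sum_mem _ fun e _ => ?_
    rw [mul_comm]
    exact Submodule.mem_iSup_of_mem (m + e)
      (hmul m e (Submodule.mul_mem_mul hf (weightedHomogeneousComponent_mem w g e)))
  | zero => rw [mul_zero]; exact Submodule.zero_mem _
  | add f f' _ _ hf hf' => rw [mul_add]; exact Submodule.add_mem _ hf hf'

/-- **The ideal generated by the `V m` is `⨆_m V m` as a `K`-subspace.** [folklore] -/
theorem restrictScalars_span_iUnion_eq
    (hmul : ∀ m e, V m * weightedHomogeneousSubmodule K w e ≤ V (m + e)) :
    Submodule.restrictScalars K (Ideal.span (⋃ m, (V m : Set (MvPolynomial σ K)))) = ⨆ m, V m := by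
  -- the `K`-subspace `⨆ V m` is an ideal
  let J : Ideal (MvPolynomial σ K) :=
    { carrier := (⨆ m, V m : Submodule K (MvPolynomial σ K))
      add_mem' := fun hf hg => Submodule.add_mem _ hf hg
      zero_mem' := Submodule.zero_mem _
      smul_mem' := fun g _ hf => mul_mem_iSup w V hmul g hf }
  refine le_antisymm ?_ (iSup_le fun m f hf => Ideal.subset_span (Set.mem_iUnion.2 ⟨m, hf⟩))
  have hle : Ideal.span (⋃ m, (V m : Set (MvPolynomial σ K))) ≤ J :=
    Ideal.span_le.2 (Set.iUnion_subset fun m f hf => Submodule.mem_iSup_of_mem m hf)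
  exact fun f hf => hle hf

/-- **The pieces of the ideal generated by the `V m` are the `V n`.**
[cite: ConnerHarperLandsberg2023, §2.3] -/
theorem span_iUnion_inf_eq [DecidableEq M] (hV : ∀ m, V m ≤ weightedHomogeneousSubmodule K w m)
    (hmul : ∀ m e, V m * weightedHomogeneousSubmodule K w e ≤ V (m + e)) (n : M) :
    Submodule.restrictScalars K (Ideal.span (⋃ m, (V m : Set (MvPolynomial σ K)))) ⊓
      weightedHomogeneousSubmodule K w n = V n := by
  rw [restrictScalars_span_iUnion_eq w V hmul, iSup_inf_eq w V hV n]

/-- The ideal generated by the `V m` is closed under weighted homogeneous components. [folklore] -/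
theorem weightedHomogeneousComponent_mem_span_iUnion [DecidableEq M]
    (hV : ∀ m, V m ≤ weightedHomogeneousSubmodule K w m)
    (hmul : ∀ m e, V m * weightedHomogeneousSubmodule K w e ≤ V (m + e)) {f : MvPolynomial σ K}
    (hf : f ∈ Ideal.span (⋃ m, (V m : Set (MvPolynomial σ K)))) (n : M) :
    weightedHomogeneousComponent w n f ∈ Ideal.span (⋃ m, (V m : Set (MvPolynomial σ K))) := by
  have hf' : f ∈ Submodule.restrictScalars K (Ideal.span (⋃ m, (V m : Set (MvPolynomial σ K)))) := hf
  rw [restrictScalars_span_iUnion_eq w V hmul] at hf'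
  exact Ideal.subset_span
    (Set.mem_iUnion.2 ⟨n, weightedHomogeneousComponent_mem_of_mem_iSup w V hV hf' n⟩)

end GradedSpan

/-- **Registered sub-goal `stub_borelFixedApolarity_graded` of `stub_borelFixedApolarity`**: in the
Cox ring `S = ℂ[C ⊕ A ⊕ B]`, a system of subspaces `V D ≤ S_D` with `V D · S_E ≤ V (D + E)` generates
a TRIHOMOGENEOUS ideal whose pieces are exactly the `V D` (the passage from the degreewise limits
`I_D = lim I(Γ_ε)_D` to one candidate ideal). [cite: ConnerHarperLandsberg2023, §2.3] -/
theorem stub_borelFixedApolarity_graded :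
    ∀ V : (Fin 3 → ℕ) → Submodule ℂ S, (∀ D, V D ≤ SD D) → (∀ D E, V D * SD E ≤ V (D + E)) →
      IsTrihomog (Ideal.span (⋃ D, (V D : Set S))) ∧
        ∀ D, piece (Ideal.span (⋃ D, (V D : Set S))) D = V D := by
  intro V hV hmul
  exact ⟨fun f hf D => GradedSpan.weightedHomogeneousComponent_mem_span_iUnion wt V hV hmul hf D,
    fun D => GradedSpan.span_iUnion_inf_eq wt V hV hmul D⟩

end Summit.MatrixMultiplication.MatrixMultiplication.Theorems.PunctualSaturation

end
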